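import Mathlib.LinearAlgebra.Matrix.SchurComplement
import Mathlib.Algebra.Polynomial.Roots
import Literature.MathematicalPhysics.QuantumLattice.BargmannHallWightman
import HarnessLib

/-!
# The complex special orthogonal group and the proper complex Lorentz group are path connected

Topic `Literature/MathematicalPhysics/QuantumLattice` (trunk T-AQFT), in the service of the
Bargmann–Hall–Wightman theorem (`BargmannHallWightman`, `BargmannHallWightmanConnected`,
`BargmannHallWightmanHolds`): the connectedness of `L₊(ℂ)` ("`L₊(ℂ)` is connected, unlike the
real case", Qiao (2022) footnote 25; Streater–Wightman §2-4) is the group-theoretic input of the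
connectedness of `{g ∈ L₊(ℂ) | gI₁ ∩ I₁ ≠ ∅}`. Everything here is **proved**:

* `BHW.Orth.exists_eq_listProd_refl` — **Cartan–Dieudonné, existence part, over `ℂ`**: every
  complex matrix `M` with `Mᵀ M = 1` is a product of reflections
  `s_a = 1 − (2 / a·a) a aᵀ` along non-isotropic vectors `a` (induction on the size: two
  reflections move `M e₀` back to `e₀`, `BHW.Orth.exists_refls_mulVec_eq`, and a matrix fixing
  `e₀` is `diag(1, N)`, `BHW.Orth.exists_blockExt_of_mulVec_e0`);
* `BHW.Orth.exists_path_of_isOrth_det_one` — **`SO(m, ℂ)` is path connected**: `det M = 1` forces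
  an even number of reflections (`det s_a = −1`, the matrix determinant lemma), and
  `s_{a₁} s_{a₂(t)}` with `a₂(t)` running from `a₁` to `a₂` through non-isotropic vectors deforms
  each pair to `1`; the non-isotropic vectors are path connected because the complex line through
  two of them meets the isotropic cone in at most two points, avoided by an arc
  `t = s + iεs(1 − s)` (`BHW.Orth.exists_arc_avoid`: each point lies on at most one such arc);
* `BHW.exists_path_properLorentz` — **`L₊(ℂ) = {Mᵀ η M = η, det M = 1}` is path connected** (as
  matrices), by conjugation with `diag(1, i, …, i)`, which squares to `η`
  (`BHW.isOrth_toOrth`, `BHW.isLorentzMat_ofOrth`).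

## Sources

* E. Cartan, J. Dieudonné: the reflection theorem for quadratic spaces over fields of
  characteristic `≠ 2` (here only the existence of some reflection decomposition is used and
  proved). [folklore]
* J. Qiao, SciPost Phys. 13 (2022) 093, footnote 25 ("`L₊(ℂ)` is connected"). [Qiao2022]
* R. F. Streater, A. S. Wightman, *PCT, Spin and Statistics, and All That*, §2-4. [StreaterWightman2001]

## Mathlib

Used: `Matrix.vecMulVec` and its algebra (`vecMulVec_mul_vecMulVec`, `vecMulVec_mulVec`,
`vecMulVec_eq`), `Matrix.det_one_add_replicateCol_mul_replicateRow` (matrix determinant lemma),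
`Polynomial.roots`, `Set.Infinite.exists_notMem_finset`, `Continuous.matrix_mul`; paths are
explicit functions continuous on `[0, 1]` (no `Path` API needed here). Mathlib's
`Matrix.orthogonalGroup n R` is `unitaryGroup n R` under the local instance `starRingOfComm`
(trivial star), which for `R = ℂ` conflicts with complex conjugation, so the plain predicate
`BHW.Orth.IsOrth M : Mᵀ M = 1` is used instead; Mathlib proves a Cartan–Dieudonné theorem only for
real inner product spaces (`LinearIsometryEquiv.reflections_generate`), and has no connectedness of
`SO(n, ℂ)` (searched `Dieudonné`, `orthogonalGroup`, `isPathConnected`).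
-/

noncomputable section

open Matrix

namespace Literature.MathematicalPhysics.QuantumLattice

namespace BHW

namespace Orth

open Set

variable {m : ℕ}

/-! ### The dot-product quadratic form and reflections -/

/-- The complex quadratic form `Q(a) = a ⬝ᵥ a`. [folklore] -/
def qf (a : Fin m → ℂ) : ℂ := a ⬝ᵥ a

/-- `Q(a + b) = Q(a) + 2 a·b + Q(b)`. [folklore] -/
theorem qf_add (a b : Fin m → ℂ) : qf (a + b) = qf a + 2 * (a ⬝ᵥ b) + qf b := by
  simp only [qf, add_dotProduct, dotProduct_add, dotProduct_comm b a]; ring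

/-- `Q(a − b) = Q(a) − 2 a·b + Q(b)`. [folklore] -/
theorem qf_sub (a b : Fin m → ℂ) : qf (a - b) = qf a - 2 * (a ⬝ᵥ b) + qf b := by
  simp only [qf, sub_dotProduct, dotProduct_sub, dotProduct_comm b a]; ring

/-- `Q(a + t c) = Q(a) + 2t a·c + t² Q(c)`. [folklore] -/
theorem qf_add_smul (a c : Fin m → ℂ) (t : ℂ) :
    qf (a + t • c) = qf a + 2 * t * (a ⬝ᵥ c) + t ^ 2 * qf c := by
  simp only [qf, add_dotProduct, dotProduct_add, dotProduct_smul, smul_dotProduct, smul_eq_mul,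
    dotProduct_comm c a]; ring

/-- A complex matrix is **orthogonal** (for the dot product) if `Mᵀ M = 1`. [folklore] -/
def IsOrth (M : Matrix (Fin m) (Fin m) ℂ) : Prop := Mᵀ * M = 1

/-- The **reflection** `s_a = 1 − (2 / Q(a)) a aᵀ` along a non-isotropic vector `a`. [folklore] -/
def refl (a : Fin m → ℂ) : Matrix (Fin m) (Fin m) ℂ :=
  1 - (2 / qf a) • vecMulVec a a

/-- `1` is orthogonal. [folklore] -/
theorem IsOrth.one : IsOrth (1 : Matrix (Fin m) (Fin m) ℂ) := by simp [IsOrth]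

/-- Products of orthogonal matrices are orthogonal. [folklore] -/
theorem IsOrth.mul {M N : Matrix (Fin m) (Fin m) ℂ} (hM : IsOrth M) (hN : IsOrth N) :
    IsOrth (M * N) := by
  unfold IsOrth at *
  rw [transpose_mul, Matrix.mul_assoc, ← Matrix.mul_assoc Mᵀ, hM, Matrix.one_mul, hN]

/-- `M Mᵀ = 1` for orthogonal `M`. [folklore] -/
theorem IsOrth.mul_transpose {M : Matrix (Fin m) (Fin m) ℂ} (hM : IsOrth M) : M * Mᵀ = 1 :=
  mul_eq_one_comm.1 hM

/-- `det M · det M = 1` for orthogonal `M`. [folklore] -/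
theorem IsOrth.det_mul_det {M : Matrix (Fin m) (Fin m) ℂ} (hM : IsOrth M) : M.det * M.det = 1 := by
  have h := congrArg det hM
  rwa [det_mul, det_transpose, det_one] at h

/-- Products of lists of orthogonal matrices are orthogonal. [folklore] -/
theorem IsOrth.listProd {L : List (Matrix (Fin m) (Fin m) ℂ)} (h : ∀ M ∈ L, IsOrth M) :
    IsOrth L.prod := by
  induction L with
  | nil => simpa using IsOrth.one
  | cons M L ih =>
    rw [List.prod_cons]
    exact (h M (by simp)).mul (ih fun N hN => h N (by simp [hN]))

/-- `(M a) ⬝ᵥ y = a ⬝ᵥ (Mᵀ y)`. [folklore] -/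
theorem mulVec_dotProduct (M : Matrix (Fin m) (Fin m) ℂ) (a y : Fin m → ℂ) :
    (M *ᵥ a) ⬝ᵥ y = a ⬝ᵥ (Mᵀ *ᵥ y) := by
  rw [Matrix.dotProduct_mulVec a, Matrix.vecMul_transpose]

/-- Orthogonal matrices preserve the dot product. [folklore] -/
theorem IsOrth.dotProduct_mulVec {M : Matrix (Fin m) (Fin m) ℂ} (hM : IsOrth M) (a b : Fin m → ℂ) :
    (M *ᵥ a) ⬝ᵥ (M *ᵥ b) = a ⬝ᵥ b := by
  unfold IsOrth at hM
  rw [mulVec_dotProduct, Matrix.mulVec_mulVec, hM, Matrix.one_mulVec]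

/-- Orthogonal matrices preserve `Q`. [folklore] -/
theorem IsOrth.qf_mulVec {M : Matrix (Fin m) (Fin m) ℂ} (hM : IsOrth M) (a : Fin m → ℂ) :
    qf (M *ᵥ a) = qf a :=
  hM.dotProduct_mulVec a a

/-- The action of a reflection: `s_a v = v − (2 a·v / Q(a)) a`. [folklore] -/
theorem refl_mulVec (a v : Fin m → ℂ) : refl a *ᵥ v = v - (2 / qf a * (a ⬝ᵥ v)) • a := by
  rw [refl, Matrix.sub_mulVec, Matrix.one_mulVec, Matrix.smul_mulVec, Matrix.vecMulVec_mulVec,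
    op_smul_eq_smul, smul_smul]

/-- Reflections are symmetric. [folklore] -/
theorem refl_transpose (a : Fin m → ℂ) : (refl a)ᵀ = refl a := by
  rw [refl, transpose_sub, transpose_one, transpose_smul, transpose_vecMulVec]

/-- `s_a a = −a`. [folklore] -/
theorem refl_mulVec_self {a : Fin m → ℂ} (ha : qf a ≠ 0) : refl a *ᵥ a = -a := by
  rw [refl_mulVec, show a ⬝ᵥ a = qf a from rfl, div_mul_cancel₀ _ ha, two_smul]
  abel

/-- `s_a v = v` when `a·v = 0`. [folklore] -/
theorem refl_mulVec_of_dotProduct_eq_zero {a v : Fin m → ℂ} (h : a ⬝ᵥ v = 0) : refl a *ᵥ v = v := by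
  rw [refl_mulVec, h, mul_zero, zero_smul, sub_zero]

/-- `s_a² = 1`. [folklore] -/
theorem refl_mul_self {a : Fin m → ℂ} (ha : qf a ≠ 0) : refl a * refl a = 1 := by
  have hP : vecMulVec a a * vecMulVec a a = qf a • vecMulVec a a := by
    rw [vecMulVec_mul_vecMulVec]
    ext i j
    simp only [vecMulVec_apply, qf, Pi.smul_apply, smul_eq_mul, Matrix.smul_apply]
    ring
  have h2 : 2 / qf a * qf a = 2 := div_mul_cancel₀ _ ha
  simp only [refl, sub_mul, mul_sub, one_mul, mul_one, smul_mul_assoc, mul_smul_comm, hP, smul_smul,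
    h2]
  module

/-- Reflections are orthogonal. [folklore] -/
theorem isOrth_refl {a : Fin m → ℂ} (ha : qf a ≠ 0) : IsOrth (refl a) := by
  unfold IsOrth; rw [refl_transpose, refl_mul_self ha]

/-- `det s_a = −1` (matrix determinant lemma). [folklore] -/
theorem det_refl {a : Fin m → ℂ} (ha : qf a ≠ 0) : (refl a).det = -1 := by
  have h : refl a = 1 + replicateCol Unit ((-(2 / qf a)) • a) * replicateRow Unit a := by
    rw [refl, vecMulVec_eq (ι := Unit), sub_eq_add_neg, ← neg_smul]
    congr 1
    ext i j
    simp [Matrix.mul_apply, replicateCol_apply, replicateRow_apply, mul_assoc]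
  rw [h, det_one_add_replicateCol_mul_replicateRow, dotProduct_smul, smul_eq_mul,
    show a ⬝ᵥ a = qf a from rfl, neg_mul, div_mul_cancel₀ _ ha]
  norm_num

/-- Products of lists of reflections: orthogonal. [folklore] -/
theorem isOrth_listProd_refl {L : List (Fin m → ℂ)} (h : ∀ a ∈ L, qf a ≠ 0) :
    IsOrth (L.map refl).prod :=
  IsOrth.listProd fun M hM => by
    obtain ⟨a, ha, rfl⟩ := List.mem_map.1 hM
    exact isOrth_refl (h a ha)

/-- Products of lists of reflections: determinant `(−1)^length`. [folklore] -/
theorem det_listProd_refl {L : List (Fin m → ℂ)} (h : ∀ a ∈ L, qf a ≠ 0) :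
    ((L.map refl).prod).det = (-1) ^ L.length := by
  induction L with
  | nil => simp
  | cons a L ih =>
    rw [List.map_cons, List.prod_cons, det_mul, det_refl (h a (by simp)),
      ih (fun b hb => h b (by simp [hb])), List.length_cons, pow_succ]
    ring

/-- The reversed product of reflections is the inverse. [folklore] -/
theorem listProd_reverse_mul {L : List (Fin m → ℂ)} (h : ∀ a ∈ L, qf a ≠ 0) :
    (L.reverse.map refl).prod * (L.map refl).prod = 1 := by
  induction L with
  | nil => simp
  | cons a L ih =>
    rw [List.reverse_cons, List.map_append, List.prod_append, List.map_cons, List.map_nil,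
      List.prod_cons, List.prod_nil, mul_one, List.map_cons, List.prod_cons, Matrix.mul_assoc,
      ← Matrix.mul_assoc (refl a), refl_mul_self (h a (by simp)), Matrix.one_mul]
    exact ih fun b hb => h b (by simp [hb])

/-! ### Two reflections move a vector to any other of the same (non-zero) length -/

/-- **Transitivity by at most two reflections**: if `Q(v) = Q(e) ≠ 0` there is a product of
reflections (one or two) mapping `v` to `e`. [folklore] -/
theorem exists_refls_mulVec_eq {v e : Fin m → ℂ} (he : qf e ≠ 0) (hv : qf v = qf e) :
    ∃ L : List (Fin m → ℂ), (∀ a ∈ L, qf a ≠ 0) ∧ (L.map refl).prod *ᵥ v = e := by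
  by_cases h1 : qf (v - e) = 0
  · -- `e·v = Q(e)`: use `s_e s_{v+e}`
    have hev : e ⬝ᵥ v = qf e := by
      rw [qf_sub, hv, dotProduct_comm] at h1
      linear_combination (-1 / 2 : ℂ) * h1
    have hq : qf (v + e) = 4 * qf e := by rw [qf_add, hv, dotProduct_comm, hev]; ring
    have hq0 : qf (v + e) ≠ 0 := by rw [hq]; exact mul_ne_zero (by norm_num) he
    refine ⟨[e, v + e], ?_, ?_⟩
    · intro a ha
      simp only [List.mem_cons, List.mem_nil_iff, or_false] at ha
      rcases ha with rfl | rfl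
      · exact he
      · exact hq0
    · have h2 : refl (v + e) *ᵥ v = -e := by
        rw [refl_mulVec, add_dotProduct, show v ⬝ᵥ v = qf v from rfl, hv, hev, hq]
        have : 2 / (4 * qf e) * (qf e + qf e) = 1 := by field_simp; ring
        rw [this, one_smul]
        abel
      simp only [List.map_cons, List.map_nil, List.prod_cons, List.prod_nil, mul_one]
      rw [← Matrix.mulVec_mulVec, h2, Matrix.mulVec_neg, refl_mulVec_self he, neg_neg]
  · refine ⟨[v - e], ?_, ?_⟩
    · intro a ha
      simp only [List.mem_cons, List.mem_nil_iff, or_false] at ha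
      subst ha
      exact h1
    · simp only [List.map_cons, List.map_nil, List.prod_cons, List.prod_nil, mul_one]
      rw [refl_mulVec, sub_dotProduct, show v ⬝ᵥ v = qf v from rfl, hv]
      have hden : qf (v - e) = 2 * (qf e - e ⬝ᵥ v) := by rw [qf_sub, hv, dotProduct_comm]; ring
      have hne : qf e - e ⬝ᵥ v ≠ 0 := by
        intro h0; apply h1; rw [hden, h0, mul_zero]
      have : 2 / qf (v - e) * (qf e - e ⬝ᵥ v) = 1 := by
        rw [hden]; field_simp
      rw [this, one_smul]
      abel

/-! ### Block structure of orthogonal matrices fixing `e₀`; the Cartan–Dieudonné induction -/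

/-- The first basis vector. [folklore] -/
def e0 : Fin (m + 1) → ℂ := Pi.single 0 1

/-- `Q(e₀) = 1`. [folklore] -/
theorem qf_e0 : qf (e0 : Fin (m + 1) → ℂ) = 1 := by
  simp [qf, e0]

/-- Extension of a vector of `ℂᵐ` by a zero first coordinate. [folklore] -/
def extVec (b : Fin m → ℂ) : Fin (m + 1) → ℂ := Fin.cons 0 b

/-- `Q(extVec b) = Q(b)`. [folklore] -/
theorem qf_extVec (b : Fin m → ℂ) : qf (extVec b) = qf b := by
  simp [qf, extVec, dotProduct, Fin.sum_univ_succ]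

/-- The block matrix `diag(1, N)`. [folklore] -/
def blockExt (N : Matrix (Fin m) (Fin m) ℂ) : Matrix (Fin (m + 1)) (Fin (m + 1)) ℂ :=
  Matrix.of fun i j => Fin.cases (Fin.cases 1 (fun _ => 0) j) (fun i' => Fin.cases 0 (fun j' => N i' j') j) i

/-- Entry `(0,0)` of `diag(1, N)`. [folklore] -/
@[simp] theorem blockExt_zero_zero (N : Matrix (Fin m) (Fin m) ℂ) : blockExt N 0 0 = 1 := rfl
/-- Entries `(0, j+1)` of `diag(1, N)`. [folklore] -/
@[simp] theorem blockExt_zero_succ (N : Matrix (Fin m) (Fin m) ℂ) (j : Fin m) : blockExt N 0 j.succ = 0 := rfl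
/-- Entries `(i+1, 0)` of `diag(1, N)`. [folklore] -/
@[simp] theorem blockExt_succ_zero (N : Matrix (Fin m) (Fin m) ℂ) (i : Fin m) : blockExt N i.succ 0 = 0 := rfl
/-- Entries `(i+1, j+1)` of `diag(1, N)`. [folklore] -/
@[simp] theorem blockExt_succ_succ (N : Matrix (Fin m) (Fin m) ℂ) (i j : Fin m) :
    blockExt N i.succ j.succ = N i j := rfl

/-- `diag(1, 1) = 1`. [folklore] -/
theorem blockExt_one : blockExt (1 : Matrix (Fin m) (Fin m) ℂ) = 1 := by
  ext i j
  refine Fin.cases ?_ (fun i' => ?_) i <;> refine Fin.cases ?_ (fun j' => ?_) j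
  · simp
  · rw [blockExt_zero_succ, Matrix.one_apply_ne (Fin.succ_ne_zero j').symm]
  · rw [blockExt_succ_zero, Matrix.one_apply_ne (Fin.succ_ne_zero i')]
  · simp [Matrix.one_apply, Fin.succ_inj]

/-- `diag(1, ·)` is multiplicative. [folklore] -/
theorem blockExt_mul (N₁ N₂ : Matrix (Fin m) (Fin m) ℂ) :
    blockExt (N₁ * N₂) = blockExt N₁ * blockExt N₂ := by
  ext i j
  refine Fin.cases ?_ (fun i' => ?_) i <;> refine Fin.cases ?_ (fun j' => ?_) j <;>
    simp [Matrix.mul_apply, Fin.sum_univ_succ]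

/-- `diag(1, ·)` on list products. [folklore] -/
theorem blockExt_listProd (L : List (Matrix (Fin m) (Fin m) ℂ)) :
    blockExt L.prod = (L.map blockExt).prod := by
  induction L with
  | nil => simp [blockExt_one]
  | cons N L ih => rw [List.prod_cons, blockExt_mul, ih, List.map_cons, List.prod_cons]

/-- The reflection along `(0, b)` is `diag(1, s_b)`. [folklore] -/
theorem refl_extVec (b : Fin m → ℂ) : refl (extVec b) = blockExt (refl b) := by
  ext i j
  rw [refl, refl, qf_extVec]
  refine Fin.cases ?_ (fun i' => ?_) i <;> refine Fin.cases ?_ (fun j' => ?_) j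
  · simp [vecMulVec_apply, extVec]
  · rw [blockExt_zero_succ, Matrix.sub_apply, Matrix.one_apply_ne (Fin.succ_ne_zero j').symm]
    simp [vecMulVec_apply, extVec]
  · rw [blockExt_succ_zero, Matrix.sub_apply, Matrix.one_apply_ne (Fin.succ_ne_zero i')]
    simp [vecMulVec_apply, extVec]
  · simp [vecMulVec_apply, extVec, Matrix.one_apply, Fin.succ_inj, Matrix.sub_apply]

/-- **An orthogonal matrix fixing `e₀` is a block matrix `diag(1, N)` with `N` orthogonal.**
[folklore] -/
theorem exists_blockExt_of_mulVec_e0 {M : Matrix (Fin (m + 1)) (Fin (m + 1)) ℂ} (hM : IsOrth M)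
    (h0 : M *ᵥ e0 = e0) : ∃ N : Matrix (Fin m) (Fin m) ℂ, IsOrth N ∧ M = blockExt N := by
  have hcol : ∀ i, M i 0 = (e0 : Fin (m + 1) → ℂ) i := by
    intro i
    have := congrFun h0 i
    rw [e0, Matrix.mulVec_single_one] at this
    exact this
  have hrow0 : Mᵀ *ᵥ e0 = e0 := by
    unfold IsOrth at hM
    calc Mᵀ *ᵥ e0 = Mᵀ *ᵥ (M *ᵥ e0) := by rw [h0]
      _ = e0 := by rw [Matrix.mulVec_mulVec, hM, Matrix.one_mulVec]
  have hrow : ∀ j, M 0 j = (e0 : Fin (m + 1) → ℂ) j := by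
    intro j
    have := congrFun hrow0 j
    rw [e0, Matrix.mulVec_single_one] at this
    exact this
  refine ⟨fun i j => M i.succ j.succ, ?_, ?_⟩
  · unfold IsOrth at hM ⊢
    ext i j
    have h := congrFun (congrFun hM i.succ) j.succ
    simp only [Matrix.mul_apply, Matrix.transpose_apply, Fin.sum_univ_succ] at h
    rw [hrow i.succ] at h
    simp only [e0, Pi.single_apply, Fin.succ_ne_zero, if_false, zero_mul, zero_add] at h
    simp only [Matrix.mul_apply, Matrix.transpose_apply]
    rw [h, Matrix.one_apply, Matrix.one_apply]
    simp [Fin.succ_inj]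
  · ext i j
    refine Fin.cases ?_ (fun i' => ?_) i <;> refine Fin.cases ?_ (fun j' => ?_) j
    · rw [hcol]; simp [e0]
    · rw [hrow]; simp [e0, Fin.succ_ne_zero]
    · rw [hcol]; simp [e0, Fin.succ_ne_zero]
    · rfl

/-- **Cartan–Dieudonné (existence): every complex orthogonal matrix is a product of reflections
along non-isotropic vectors.** [folklore] -/
theorem exists_eq_listProd_refl :
    ∀ (m : ℕ) (M : Matrix (Fin m) (Fin m) ℂ), IsOrth M →
      ∃ L : List (Fin m → ℂ), (∀ a ∈ L, qf a ≠ 0) ∧ M = (L.map refl).prod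
  | 0, M, _ => ⟨[], by simp, Subsingleton.elim _ _⟩
  | m + 1, M, hM => by
    set v := M *ᵥ e0 with hv
    have hvq : qf v = qf (e0 : Fin (m + 1) → ℂ) := hM.qf_mulVec e0
    obtain ⟨L₁, hL₁, hR⟩ := exists_refls_mulVec_eq (e := e0) (by rw [qf_e0]; exact one_ne_zero) hvq
    set R := (L₁.map refl).prod with hRdef
    have hRo : IsOrth R := isOrth_listProd_refl hL₁
    have hM' : IsOrth (R * M) := hRo.mul hM
    have hfix : (R * M) *ᵥ e0 = e0 := by rw [← Matrix.mulVec_mulVec, ← hv]; exact hR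
    obtain ⟨N, hN, hRM⟩ := exists_blockExt_of_mulVec_e0 hM' hfix
    obtain ⟨bs, hbs, hNeq⟩ := exists_eq_listProd_refl m N hN
    refine ⟨L₁.reverse ++ bs.map extVec, ?_, ?_⟩
    · intro a ha
      rcases List.mem_append.1 ha with ha | ha
      · exact hL₁ a (List.mem_reverse.1 ha)
      · obtain ⟨b, hb, rfl⟩ := List.mem_map.1 ha
        rw [qf_extVec]; exact hbs b hb
    · have h1 : M = (L₁.reverse.map refl).prod * (R * M) := by
        rw [← Matrix.mul_assoc, hRdef, listProd_reverse_mul hL₁, Matrix.one_mul]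
      have hfun : (blockExt ∘ refl : (Fin m → ℂ) → Matrix (Fin (m + 1)) (Fin (m + 1)) ℂ) =
          refl ∘ extVec := by
        funext b; simp [Function.comp, refl_extVec]
      rw [h1, hRM, hNeq, blockExt_listProd, List.map_append, List.prod_append, List.map_map,
        List.map_map, hfun]

/-! ### Paths -/

/-- The arc `s ↦ s + iε s(1 − s)` from `0` to `1` in `ℂ`. [folklore] -/
def arc (ε s : ℝ) : ℂ := (s : ℂ) + ((ε * s * (1 - s) : ℝ) : ℂ) * Complex.I

/-- The arc starts at `0`. [folklore] -/
@[simp] theorem arc_zero (ε : ℝ) : arc ε 0 = 0 := by simp [arc]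
/-- The arc ends at `1`. [folklore] -/
@[simp] theorem arc_one (ε : ℝ) : arc ε 1 = 1 := by simp [arc]

/-- The arc is continuous. [folklore] -/
theorem continuous_arc (ε : ℝ) : Continuous (arc ε) := by
  unfold arc; fun_prop

/-- **Arcs avoid finite sets**: for a finite set `F ∌ 0, 1` and infinitely many candidate `ε`, some
arc `s + iεs(1−s)` misses `F` (each point of `F` lies on at most one arc). [folklore] -/
theorem exists_arc_avoid (F : Finset ℂ) (h0 : (0 : ℂ) ∉ F) (h1 : (1 : ℂ) ∉ F) {S : Set ℝ}
    (hS : S.Infinite) : ∃ ε ∈ S, ∀ s ∈ Icc (0 : ℝ) 1, arc ε s ∉ F := by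
  obtain ⟨ε, hεS, hε⟩ := hS.exists_notMem_finset (F.image fun z => z.im / (z.re * (1 - z.re)))
  refine ⟨ε, hεS, fun s hs hmem => hε ?_⟩
  rw [Finset.mem_image]
  refine ⟨arc ε s, hmem, ?_⟩
  have hre : (arc ε s).re = s := by simp [arc]
  have him : (arc ε s).im = ε * s * (1 - s) := by simp [arc]
  rw [hre, him]
  have hs0 : s ≠ 0 := by rintro rfl; exact h0 (by simpa using hmem)
  have hs1 : s ≠ 1 := by rintro rfl; exact h1 (by simpa using hmem)
  have : s * (1 - s) ≠ 0 := mul_ne_zero hs0 (sub_ne_zero.2 (Ne.symm hs1))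
  field_simp

/-- **The non-isotropic vectors are path connected** (through the complex line joining two of them,
along an arc avoiding the at most two isotropic points). [folklore] -/
theorem exists_path_qf_ne_zero {a b : Fin m → ℂ} (ha : qf a ≠ 0) (hb : qf b ≠ 0) :
    ∃ γ : ℝ → (Fin m → ℂ), Continuous γ ∧ γ 0 = a ∧ γ 1 = b ∧ ∀ s ∈ Icc (0 : ℝ) 1, qf (γ s) ≠ 0 := by
  set c := b - a with hc
  set q : Polynomial ℂ := Polynomial.C (qf a) + Polynomial.C (2 * (a ⬝ᵥ c)) * Polynomial.X +
    Polynomial.C (qf c) * Polynomial.X ^ 2 with hq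
  have heval : ∀ t : ℂ, q.eval t = qf (a + t • c) := by
    intro t; rw [qf_add_smul]; simp [hq]; ring
  have hq0 : q ≠ 0 := by
    intro h
    have := heval 0
    rw [h, Polynomial.eval_zero, zero_smul, add_zero] at this
    exact ha this.symm
  set F := q.roots.toFinset with hF
  have hmemF : ∀ t, t ∈ F ↔ qf (a + t • c) = 0 := by
    intro t; rw [hF, Multiset.mem_toFinset, Polynomial.mem_roots hq0, Polynomial.IsRoot.def, heval]
  have h0F : (0 : ℂ) ∉ F := by rw [hmemF]; simpa using ha
  have h1F : (1 : ℂ) ∉ F := by rw [hmemF]; simp [hc, hb]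
  obtain ⟨ε, -, hε⟩ := exists_arc_avoid F h0F h1F Set.infinite_univ
  refine ⟨fun s => a + arc ε s • c, continuous_const.add ((continuous_arc ε).smul continuous_const),
    by simp, by simp [hc], fun s hs => ?_⟩
  exact fun h => hε s hs ((hmemF _).2 h)

/-- Reflections depend continuously on the (non-isotropic) vector. [folklore] -/
theorem continuousOn_refl : ContinuousOn (refl : (Fin m → ℂ) → Matrix (Fin m) (Fin m) ℂ) {a | qf a ≠ 0} := by
  have hq : Continuous (qf : (Fin m → ℂ) → ℂ) := by
    unfold qf dotProduct; fun_prop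
  have hP : Continuous fun a : Fin m → ℂ => vecMulVec a a := by
    refine continuous_pi fun i => continuous_pi fun j => ?_
    simp only [vecMulVec_apply]; fun_prop
  unfold refl
  refine continuousOn_const.sub (ContinuousOn.smul (f := fun a : Fin m → ℂ => 2 / qf a)
    (g := fun a : Fin m → ℂ => vecMulVec a a) ?_ hP.continuousOn)
  exact continuousOn_const.div hq.continuousOn fun a ha => ha

/-- **A product of an even number of reflections is joined to `1` inside `SO`.** [folklore] -/
theorem exists_path_listProd_refl :
    ∀ (k : ℕ) (L : List (Fin m → ℂ)), L.length = 2 * k → (∀ a ∈ L, qf a ≠ 0) →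
      ∃ Γ : ℝ → Matrix (Fin m) (Fin m) ℂ, ContinuousOn Γ (Icc 0 1) ∧ Γ 0 = 1 ∧
        Γ 1 = (L.map refl).prod ∧ ∀ s ∈ Icc (0 : ℝ) 1, IsOrth (Γ s) ∧ (Γ s).det = 1
  | 0, L, hL, _ => by
    have : L = [] := List.eq_nil_of_length_eq_zero (by simpa using hL)
    subst this
    exact ⟨fun _ => 1, continuousOn_const, rfl, by simp, fun s _ => ⟨IsOrth.one, det_one⟩⟩
  | k + 1, L, hL, hq => by
    match L, hL with
    | a :: b :: L', hL =>
      have hL' : L'.length = 2 * k := by simp [List.length_cons] at hL; omega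
      have ha : qf a ≠ 0 := hq a (by simp)
      have hb : qf b ≠ 0 := hq b (by simp)
      obtain ⟨Γ', hΓ'c, hΓ'0, hΓ'1, hΓ'⟩ :=
        exists_path_listProd_refl k L' hL' fun x hx => hq x (by simp [hx])
      obtain ⟨γ, hγc, hγ0, hγ1, hγ⟩ := exists_path_qf_ne_zero ha hb
      refine ⟨fun s => refl a * refl (γ s) * Γ' s, ?_, ?_, ?_, fun s hs => ⟨?_, ?_⟩⟩
      · refine ((continuousOn_const.mul ?_).mul hΓ'c)
        exact continuousOn_refl.comp hγc.continuousOn fun s hs => hγ s hs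
      · simp only [hγ0, hΓ'0, Matrix.mul_one, refl_mul_self ha]
      · simp only [hγ1, hΓ'1, List.map_cons, List.prod_cons, Matrix.mul_assoc]
      · exact ((isOrth_refl ha).mul (isOrth_refl (hγ s hs))).mul (hΓ' s hs).1
      · rw [det_mul, det_mul, det_refl ha, det_refl (hγ s hs), (hΓ' s hs).2]; norm_num

/-- **The complex special orthogonal group is path connected**: every orthogonal matrix of
determinant one is joined to `1` by a continuous path of such matrices (Cartan–Dieudonné: it is a
product of an even number of reflections `s_{a₁} s_{a₂} ⋯`, and `s_{a₁} s_{a₂(t)}` with `a₂(t)`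
moving from `a₁` to `a₂` through non-isotropic vectors deforms each pair to `1`). [folklore] -/
theorem exists_path_of_isOrth_det_one {M : Matrix (Fin m) (Fin m) ℂ} (hM : IsOrth M) (hdet : M.det = 1) :
    ∃ Γ : ℝ → Matrix (Fin m) (Fin m) ℂ, ContinuousOn Γ (Icc 0 1) ∧ Γ 0 = 1 ∧ Γ 1 = M ∧
      ∀ s ∈ Icc (0 : ℝ) 1, IsOrth (Γ s) ∧ (Γ s).det = 1 := by
  obtain ⟨L, hL, rfl⟩ := exists_eq_listProd_refl m M hM
  have heven : Even L.length := by
    have h := det_listProd_refl hL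
    rw [hdet] at h
    exact (neg_one_pow_eq_one_iff_even (by norm_num)).1 h.symm
  obtain ⟨k, hk⟩ := heven
  exact exists_path_listProd_refl k L (by omega) hL


end Orth

/-! ### The proper complex Lorentz group is path connected -/

section LorentzConnected

open Set

variable {d : ℕ}

/-- The diagonal matrix `W = diag(1, i, …, i)`, with `W² = η`. [folklore] -/
def wickS : Matrix (Fin (d + 1)) (Fin (d + 1)) ℂ :=
  Matrix.diagonal fun μ => if μ = 0 then 1 else Complex.I

/-- `W⁻¹ = diag(1, −i, …, −i)`. [folklore] -/
def wickSInv : Matrix (Fin (d + 1)) (Fin (d + 1)) ℂ :=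
  Matrix.diagonal fun μ => if μ = 0 then 1 else -Complex.I

/-- `W W⁻¹ = 1`. [folklore] -/
theorem wickS_mul_wickSInv : (wickS : Matrix (Fin (d + 1)) (Fin (d + 1)) ℂ) * wickSInv = 1 := by
  rw [wickS, wickSInv, Matrix.diagonal_mul_diagonal, ← Matrix.diagonal_one]
  congr 1; funext μ; by_cases h : μ = 0 <;> simp [h]

/-- `W⁻¹ W = 1`. [folklore] -/
theorem wickSInv_mul_wickS : (wickSInv : Matrix (Fin (d + 1)) (Fin (d + 1)) ℂ) * wickS = 1 := by
  rw [wickS, wickSInv, Matrix.diagonal_mul_diagonal, ← Matrix.diagonal_one]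
  congr 1; funext μ; by_cases h : μ = 0 <;> simp [h]

/-- `W W = η`. [folklore] -/
theorem wickS_mul_wickS : (wickS : Matrix (Fin (d + 1)) (Fin (d + 1)) ℂ) * wickS = minkMat d ℂ := by
  rw [wickS, minkMat, Matrix.diagonal_mul_diagonal]
  congr 1; funext μ; by_cases h : μ = 0 <;> simp [h]

/-- `W⁻¹ W⁻¹ = η`. [folklore] -/
theorem wickSInv_mul_wickSInv :
    (wickSInv : Matrix (Fin (d + 1)) (Fin (d + 1)) ℂ) * wickSInv = minkMat d ℂ := by
  rw [wickSInv, minkMat, Matrix.diagonal_mul_diagonal]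
  congr 1; funext μ; by_cases h : μ = 0 <;> simp [h]

/-- `W` is symmetric. [folklore] -/
@[simp] theorem wickS_transpose : (wickS : Matrix (Fin (d + 1)) (Fin (d + 1)) ℂ)ᵀ = wickS :=
  Matrix.diagonal_transpose _

/-- `W⁻¹` is symmetric. [folklore] -/
@[simp] theorem wickSInv_transpose : (wickSInv : Matrix (Fin (d + 1)) (Fin (d + 1)) ℂ)ᵀ = wickSInv :=
  Matrix.diagonal_transpose _

/-- The conjugate `W M W⁻¹`. [folklore] -/
def toOrth (M : Matrix (Fin (d + 1)) (Fin (d + 1)) ℂ) : Matrix (Fin (d + 1)) (Fin (d + 1)) ℂ :=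
  wickS * M * wickSInv

/-- The inverse conjugation `W⁻¹ O W`. [folklore] -/
def ofOrth (O : Matrix (Fin (d + 1)) (Fin (d + 1)) ℂ) : Matrix (Fin (d + 1)) (Fin (d + 1)) ℂ :=
  wickSInv * O * wickS

/-- `W⁻¹ (W M W⁻¹) W = M`. [folklore] -/
theorem ofOrth_toOrth (M : Matrix (Fin (d + 1)) (Fin (d + 1)) ℂ) : ofOrth (toOrth M) = M := by
  unfold ofOrth toOrth
  calc wickSInv * (wickS * M * wickSInv) * wickS = (wickSInv * wickS) * M * (wickSInv * wickS) := by
        simp only [Matrix.mul_assoc]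
    _ = M := by rw [wickSInv_mul_wickS, Matrix.one_mul, Matrix.mul_one]

/-- `W⁻¹ 1 W = 1`. [folklore] -/
theorem ofOrth_one : ofOrth (1 : Matrix (Fin (d + 1)) (Fin (d + 1)) ℂ) = 1 := by
  rw [ofOrth, Matrix.mul_one, wickSInv_mul_wickS]

/-- **A Lorentz matrix conjugates to a complex orthogonal matrix.** [folklore] -/
theorem isOrth_toOrth {M : Matrix (Fin (d + 1)) (Fin (d + 1)) ℂ} (hM : IsLorentzMat M) :
    Orth.IsOrth (toOrth M) := by
  unfold Orth.IsOrth toOrth IsLorentzMat at *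
  rw [Matrix.transpose_mul, Matrix.transpose_mul, wickS_transpose, wickSInv_transpose]
  calc wickSInv * (Mᵀ * wickS) * (wickS * M * wickSInv)
        = wickSInv * (Mᵀ * (wickS * wickS) * M) * wickSInv := by simp only [Matrix.mul_assoc]
    _ = wickSInv * (wickS * wickS) * wickSInv := by rw [wickS_mul_wickS, hM]
    _ = (wickSInv * wickS) * (wickS * wickSInv) := by simp only [Matrix.mul_assoc]
    _ = 1 := by rw [wickSInv_mul_wickS, wickS_mul_wickSInv, Matrix.mul_one]

/-- **A complex orthogonal matrix conjugates back to a Lorentz matrix.** [folklore] -/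
theorem isLorentzMat_ofOrth {O : Matrix (Fin (d + 1)) (Fin (d + 1)) ℂ} (hO : Orth.IsOrth O) :
    IsLorentzMat (ofOrth O) := by
  unfold Orth.IsOrth ofOrth IsLorentzMat at *
  rw [Matrix.transpose_mul, Matrix.transpose_mul, wickS_transpose, wickSInv_transpose]
  calc wickS * (Oᵀ * wickSInv) * minkMat d ℂ * (wickSInv * O * wickS)
        = wickS * (Oᵀ * (wickSInv * minkMat d ℂ * wickSInv) * O) * wickS := by
          simp only [Matrix.mul_assoc]
    _ = wickS * (Oᵀ * O) * wickS := by
          rw [← wickS_mul_wickS, show (wickSInv : Matrix (Fin (d + 1)) (Fin (d + 1)) ℂ) *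
            (wickS * wickS) * wickSInv = (wickSInv * wickS) * (wickS * wickSInv) by
              simp only [Matrix.mul_assoc], wickSInv_mul_wickS, wickS_mul_wickSInv, Matrix.mul_one,
            Matrix.mul_one]
    _ = minkMat d ℂ := by rw [hO, Matrix.mul_one, wickS_mul_wickS]

/-- `det (W⁻¹ O W) = det O`. [folklore] -/
theorem det_ofOrth (O : Matrix (Fin (d + 1)) (Fin (d + 1)) ℂ) : (ofOrth O).det = O.det := by
  rw [ofOrth, Matrix.det_mul, Matrix.det_mul, mul_comm (wickSInv.det), mul_assoc, ← Matrix.det_mul,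
    wickSInv_mul_wickS, Matrix.det_one, mul_one]

/-- `det (W M W⁻¹) = det M`. [folklore] -/
theorem det_toOrth (M : Matrix (Fin (d + 1)) (Fin (d + 1)) ℂ) : (toOrth M).det = M.det := by
  rw [toOrth, Matrix.det_mul, Matrix.det_mul, mul_comm (wickS.det), mul_assoc, ← Matrix.det_mul,
    wickS_mul_wickSInv, Matrix.det_one, mul_one]

/-- **The proper complex Lorentz group `L₊(ℂ)` is path connected** (as matrices: every Lorentz
matrix of determinant one is joined to `1` through such matrices; by conjugation with
`diag(1, i, …, i)` from the complex special orthogonal group, `Orth.exists_path_of_isOrth_det_one`).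
[folklore] -/
theorem exists_path_properLorentz {M : Matrix (Fin (d + 1)) (Fin (d + 1)) ℂ} (hM : IsLorentzMat M)
    (hdet : M.det = 1) :
    ∃ Γ : ℝ → Matrix (Fin (d + 1)) (Fin (d + 1)) ℂ, ContinuousOn Γ (Icc 0 1) ∧ Γ 0 = 1 ∧ Γ 1 = M ∧
      ∀ s ∈ Icc (0 : ℝ) 1, IsLorentzMat (Γ s) ∧ (Γ s).det = 1 := by
  obtain ⟨Γ₀, hc, h0, h1, hΓ₀⟩ := Orth.exists_path_of_isOrth_det_one (isOrth_toOrth hM)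
    (by rw [det_toOrth, hdet])
  have hcont : Continuous (ofOrth : Matrix (Fin (d + 1)) (Fin (d + 1)) ℂ → _) :=
    (continuous_const.matrix_mul continuous_id).matrix_mul continuous_const
  refine ⟨fun s => ofOrth (Γ₀ s), hcont.comp_continuousOn hc, ?_, ?_,
    fun s hs => ⟨isLorentzMat_ofOrth (hΓ₀ s hs).1, ?_⟩⟩
  · show ofOrth (Γ₀ 0) = 1
    rw [h0, ofOrth_one]
  · show ofOrth (Γ₀ 1) = M
    rw [h1, ofOrth_toOrth]
  · show (ofOrth (Γ₀ s)).det = 1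
    rw [det_ofOrth, (hΓ₀ s hs).2]

end LorentzConnected

end BHW

end Literature.MathematicalPhysics.QuantumLattice
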